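import Summits.NavierStokesRegularity.NavierStokesRegularity.Theorems.ScenarioCensusRowF1IntQuenchTop
import Summits.NavierStokesRegularity.NavierStokesRegularity.Theorems.ScenarioCensusRowF1Socket
import HarnessLib

/-!
# LINE 26 «rate-table» port, part 2/5: §7 THE TWO NEW KILLS — weak maximum principles on whole-space slabs for the weighted enstrophy density: the transport sub-solution
# comparison `le_of_transportSubsolution`

Re-homed for the scenario census (typer seat ns-census-typer-1 g9; the cells F1im / F1id and the floors DM / DI are MEMBERS OF RECORD «DECIDED IN KERNEL IN FILES» of row F1
since census v1.78 (critic idea-crit-3 PASS; ref ns-census-ref g10 PRE-CHECK ✓ §15.23 item 45; lead-presearch label); this port makes them TREE-decided): VERBATIM PORT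
of the NEW declarations (§1 material / ideal read-outs, §7 maximum principles, §9 rows) of ns-idea-3 LINE 26 «rate-table»,
`pub/ideators/ns-idea-3/lines/rate-table/line-rate-table.lean` sha16 99519954933d87d3 (2726 l., lean check rc 0, 0 sorry; the frame of §1, the Eulerian read-outs, §2–§6 and §8
are shared VERBATIM with LINES 18/20/22/24/25/27 and taken BY NAME from the landed ports — not re-declared), split for the 400-line rule into `ScenarioCensusRowF1RateTable`
(§1) → `…RateTableMaxPrinciple` (§7a) → `…RateTableKill` (§7b) → `…RateTableRows` (§9 rows/verdicts) → `…RateTableTop` (§9 corollaries + census KEYS).  Lean text VERBATIM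
in namespace `…Theorems.ScenarioCensus.RateTable` (the line's `…Cruxes.ScenarioCensusRowF1.RateTableLine` re-homed), shared names spelled by namespace (`EulerianPincer.…`,
`LiouvilleSocket.…`, `FrozenTop.…`, `InviscidTop.…`, …); port edits: the bracket lines `section …` / `end …` dropped (no `variable`s), `@[conjecture]` on the residual
`TableSlack` (≡ `ScenarioCensus.Row_F1`, OPEN), one-line docstrings added where missing (gate lint), two `have` statements spell the τ-tool's `lapD` (defeq; proof text
only).  Statements untouched.

No census VALUE is moved here (row F1 stays OPEN-WITH-LINE; the members become TREE-decided by name); NS regularity is NOT proved; `Row_F1` is untouched (zero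
movement, `tableSlack_iff_rowF1`); no summit statement is proved by this file. Lemmas that restate already-landed tree declarations are taken BY NAME (gate lint `dedup.landed`): `materialNonIncreasing_ancient_trivial` = `IntegratedQuench.eq_zero_of_nonIntensifying`.
-/

-- the summit and its single problem share the name `NavierStokesRegularity` (D-0017 nested layout)
set_option linter.dupNamespace false

noncomputable section

open MeasureTheory Set Function Filter TopologicalSpace Metric
open scoped Topology NNReal ENNReal InnerProductSpace RealInnerProductSpace Laplacian

namespace Summit.NavierStokesRegularity.NavierStokesRegularity.Theorems.ScenarioCensus.RateTable

open Literature.Analysis Literature.Analysis.FluidPDE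
open Summit.NavierStokesRegularity.NavierStokesRegularity.Theorems

/-! ## §7 THE TWO NEW KILLS: WEAK MAXIMUM PRINCIPLES on whole-space slabs for the weighted enstrophy density
`q(s, y) = (−s)^{2θ} |ω̃(s, y)|²` of `W ∈ 𝒦` — FIRST ORDER with bounded drift (material cell; the transport maximum
principle is proved here) and SECOND ORDER without drift (ideal cell; tree `le_of_subsolution` with `b = 0`)

The Eulerian hypothesis of LINE 25 controls the full time derivative of `|ω̃|²` at each point (an ODE on vertical lines).
The MATERIAL hypothesis `⟪ω̃, ∂ₛω̃ + (W·∇)ω̃⟫ ≤ θ|ω̃|²/(−s)` controls only the derivative ALONG THE FLOW of `W`: it makes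
`q` a bounded TRANSPORT SUBSOLUTION `∂ₛq + W·∇q ≤ 0` with bounded drift on every slab `[s₀, s₁] × ℝ³` (`s₁ < 0`), and
the first-order weak maximum principle below (Tikhonov barrier `e^{K(s−s₀)}(1 + |y|²)`, no characteristics, no decay
at infinity) gives `q ≤ sup q(s₀, ·) ≤ K²(−s₀)^{2θ−2} → 0` as `s₀ → −∞` when `θ < 1`.  The IDEAL hypothesis
`⟪ω̃, ∂ₛω̃ − Δω̃⟫ ≤ θ|ω̃|²/(−s)` makes `q` a bounded HEAT SUBSOLUTION `∂ₛq ≤ Δq` (Kato: `Δ|ω̃|² = 2⟪Δω̃, ω̃⟫ + 2|∇ω̃|²`),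
and the tree's whole-space weak maximum principle (`HalfSpaceWindowDoorCirculationCarryingRigidityWholeSpaceMaxPrinciple.
le_of_subsolution`, drift `0`) gives the same conclusion. -/

/-- **FIRST-ORDER WEAK MAXIMUM PRINCIPLE ON WHOLE-SPACE SLABS FOR BOUNDED TRANSPORT SUBSOLUTIONS WITH BOUNDED DRIFT
(no decay at infinity).**  `q` jointly continuous and bounded above on `[s₀, s₁] × ℝ³`, `q(s₀, ·) ≤ m`, and at every
point of `(s₀, s₁] × ℝ³` where `q > m`: `|b| ≤ Λ`, the slice `q(t, ·)` is differentiable and `∂ₜq + Dq[b] ≤ 0` for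
some time derivative.  Then `q ≤ m` on the slab.  Proof: the tree's barrier argument for `le_of_subsolution` with the
Laplacian deleted — `Φ = q − ε e^{K(t−s₀)}(1+|x|²) − δ(t − s₀)`, `K = 2Λ + 6`, attains an interior maximum on a large
compact cylinder, where the first-order conditions contradict `∂ₜψ + b·∇ψ ≥ 0`. -/
theorem le_of_transportSubsolution {q : ℝ → LiouvilleSocket.E3 → ℝ} {b : ℝ → LiouvilleSocket.E3 → LiouvilleSocket.E3} {s₀ s₁ Λ B m : ℝ} (hΛ : 0 ≤ Λ)
    (hcont : ContinuousOn (uncurry q) (Icc s₀ s₁ ×ˢ univ))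
    (hB : ∀ t ∈ Icc s₀ s₁, ∀ x, q t x ≤ B)
    (hinit : ∀ x, q s₀ x ≤ m)
    (hsub : ∀ t ∈ Ioc s₀ s₁, ∀ x, m < q t x →
      ‖b t x‖ ≤ Λ ∧ DifferentiableAt ℝ (q t) x ∧
      (∃ d : ℝ, HasDerivAt (fun τ => q τ x) d t ∧ d + fderiv ℝ (q t) x (b t x) ≤ 0)) :
    ∀ t ∈ Icc s₀ s₁, ∀ x, q t x ≤ m := by
  intro t ht x
  by_contra hlt
  push Not at hlt
  set K : ℝ := 2 * Λ + 6 with hK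
  have hK0 : 0 ≤ K := by positivity
  set ψ : ℝ → LiouvilleSocket.E3 → ℝ := fun τ y => Real.exp (K * (τ - s₀)) * (1 + ‖y‖ ^ 2) with hψ
  have hψpos : ∀ τ y, 0 < ψ τ y := fun τ y => by positivity
  have hψge : ∀ τ, s₀ ≤ τ → ∀ y, 1 + ‖y‖ ^ 2 ≤ ψ τ y := by
    intro τ hτ y
    have : 1 ≤ Real.exp (K * (τ - s₀)) := Real.one_le_exp (by nlinarith)
    have h0 : 0 ≤ 1 + ‖y‖ ^ 2 := by positivity
    nlinarith
  -- the perturbation parameters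
  set η : ℝ := q t x - m with hη
  have hηpos : 0 < η := by linarith
  set ε : ℝ := η / (4 * ψ t x) with hε
  have hεpos : 0 < ε := by positivity
  set δ : ℝ := η / (4 * (s₁ - s₀ + 1)) with hδ
  have hs01 : s₀ ≤ s₁ := ht.1.trans ht.2
  have hδpos : 0 < δ := by rw [hδ]; exact div_pos hηpos (by linarith)
  set Φ : ℝ → LiouvilleSocket.E3 → ℝ := fun τ y => q τ y - ε * ψ τ y - δ * (τ - s₀) with hΦ
  have hΦtx : m + η / 2 ≤ Φ t x := by
    have e1 : ε * ψ t x = η / 4 := by rw [hε]; field_simp [(hψpos t x).ne']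
    have e2 : δ * (t - s₀) ≤ η / 4 := by
      rw [hδ, div_mul_eq_mul_div, div_le_iff₀ (by linarith)]
      nlinarith [ht.1, ht.2]
    show m + η / 2 ≤ q t x - ε * ψ t x - δ * (t - s₀)
    linarith
  -- the radius beyond which `Φ < m`
  set R : ℝ := ‖x‖ + 1 + |B - m + 1| / ε with hR
  have hR1 : 1 ≤ R := by
    have : 0 ≤ |B - m + 1| / ε := by positivity
    rw [hR]; nlinarith [norm_nonneg x]
  have hxR : ‖x‖ < R := by
    have : 0 ≤ |B - m + 1| / ε := by positivity
    rw [hR]; linarith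
  have hfar : ∀ τ ∈ Icc s₀ s₁, ∀ y : LiouvilleSocket.E3, R ≤ ‖y‖ → Φ τ y ≤ m - 1 := by
    intro τ hτ y hy
    have h1 : ε * R ^ 2 ≥ |B - m + 1| := by
      have hR2 : R ≤ R ^ 2 := by nlinarith
      have : |B - m + 1| / ε ≤ R := by rw [hR]; linarith [norm_nonneg x]
      rw [div_le_iff₀ hεpos] at this
      nlinarith
    have h2 : ε * ψ τ y ≥ ε * (1 + ‖y‖ ^ 2) := mul_le_mul_of_nonneg_left (hψge τ hτ.1 y) hεpos.le
    have h3 : ‖y‖ ^ 2 ≥ R ^ 2 := by nlinarith [norm_nonneg y]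
    have h4 : 0 ≤ δ * (τ - s₀) := mul_nonneg hδpos.le (by linarith [hτ.1])
    have h5 := hB τ hτ y
    have h6 := le_abs_self (B - m + 1)
    show q τ y - ε * ψ τ y - δ * (τ - s₀) ≤ m - 1
    nlinarith
  -- continuity of `Φ` on the compact cylinder and a maximum point
  set S : Set (ℝ × LiouvilleSocket.E3) := Icc s₀ s₁ ×ˢ closedBall (0 : LiouvilleSocket.E3) R with hS
  have hSc : IsCompact S := isCompact_Icc.prod (isCompact_closedBall _ _)
  have hSne : S.Nonempty := ⟨(t, x), ht, mem_closedBall_zero_iff.2 hxR.le⟩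
  have hΦc : ContinuousOn (uncurry Φ) S := by
    have hq : ContinuousOn (uncurry q) S := hcont.mono (prod_mono Subset.rfl (subset_univ _))
    have hψc : Continuous (uncurry ψ) := by
      show Continuous fun p : ℝ × LiouvilleSocket.E3 => Real.exp (K * (p.1 - s₀)) * (1 + ‖p.2‖ ^ 2)
      fun_prop
    have hlin : Continuous fun p : ℝ × LiouvilleSocket.E3 => δ * (p.1 - s₀) := by fun_prop
    have : ContinuousOn (fun p : ℝ × LiouvilleSocket.E3 => uncurry q p - ε * uncurry ψ p - δ * (p.1 - s₀)) S :=
      (hq.sub (hψc.continuousOn.const_smul ε |>.congr fun p _ => by simp [smul_eq_mul])).sub hlin.continuousOn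
    exact this.congr fun p _ => by simp [hΦ, uncurry]
  obtain ⟨p₁, hp₁S, hmax⟩ := hSc.exists_isMaxOn hSne hΦc
  obtain ⟨t₁, x₁⟩ := p₁
  obtain ⟨ht₁, hx₁⟩ : t₁ ∈ Icc s₀ s₁ ∧ x₁ ∈ closedBall (0 : LiouvilleSocket.E3) R := hp₁S
  have hge : Φ t x ≤ Φ t₁ x₁ := hmax (show ((t, x) : ℝ × LiouvilleSocket.E3) ∈ S from ⟨ht, mem_closedBall_zero_iff.2 hxR.le⟩)
  have hΦ₁ : m + η / 2 ≤ Φ t₁ x₁ := hΦtx.trans hge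
  -- `t₁ > s₀`
  have ht₁0 : s₀ < t₁ := by
    rcases ht₁.1.eq_or_lt with h | h
    · exfalso
      have h1 : Φ t₁ x₁ ≤ q t₁ x₁ := by
        show q t₁ x₁ - ε * ψ t₁ x₁ - δ * (t₁ - s₀) ≤ q t₁ x₁
        nlinarith [hψpos t₁ x₁, h]
      have h2 : q t₁ x₁ ≤ m := by rw [← h]; exact hinit x₁
      linarith
    · exact h
  -- `‖x₁‖ < R`
  have hx₁R : ‖x₁‖ < R := by
    by_contra hc
    push Not at hc
    linarith [hfar t₁ ht₁ x₁ hc]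
  -- `q(t₁,x₁) > m`
  have hq₁ : m < q t₁ x₁ := by
    have h1 : Φ t₁ x₁ ≤ q t₁ x₁ := by
      show q t₁ x₁ - ε * ψ t₁ x₁ - δ * (t₁ - s₀) ≤ q t₁ x₁
      nlinarith [hψpos t₁ x₁, ht₁.1, hδpos]
    linarith
  obtain ⟨hb, hqdiff, ⟨d, hd, hineq⟩⟩ := hsub t₁ ⟨ht₁0, ht₁.2⟩ x₁ hq₁
  -- the first-order spatial condition at the interior maximum
  have hloc : IsLocalMax (Φ t₁) x₁ := by
    have hball : ball (0 : LiouvilleSocket.E3) R ∈ 𝓝 x₁ := isOpen_ball.mem_nhds (mem_ball_zero_iff.2 hx₁R)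
    filter_upwards [hball] with y hy
    exact hmax (show ((t₁, y) : ℝ × LiouvilleSocket.E3) ∈ S from ⟨ht₁, ball_subset_closedBall hy⟩)
  have hDΦ : fderiv ℝ (Φ t₁) x₁ = 0 := hloc.fderiv_eq_zero
  have hDq : fderiv ℝ (q t₁) x₁ (b t₁ x₁) = ε * (Real.exp (K * (t₁ - s₀)) * (2 * ⟪x₁, b t₁ x₁⟫_ℝ)) := by
    have hψD := (HalfSpaceWindowDoorCirculationCarryingRigidityWholeSpaceMaxPrinciple.hasFDerivAt_barrier_slice
      (K * (t₁ - s₀)) x₁).const_mul ε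
    have hqD : HasFDerivAt (q t₁) (fderiv ℝ (q t₁) x₁) x₁ := hqdiff.hasFDerivAt
    have hΦD : HasFDerivAt (Φ t₁)
        (fderiv ℝ (q t₁) x₁ - ε • (Real.exp (K * (t₁ - s₀)) • ((2 : ℝ) • innerSL ℝ x₁))) x₁ := by
      have h := (hqD.sub hψD).sub_const (δ * (t₁ - s₀))
      exact h.congr_fderiv rfl
    have h0 := hΦD.fderiv
    rw [hDΦ] at h0
    have h1 : fderiv ℝ (q t₁) x₁ = ε • (Real.exp (K * (t₁ - s₀)) • ((2 : ℝ) • innerSL ℝ x₁)) := by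
      rw [eq_comm, sub_eq_zero] at h0; exact h0
    rw [h1]
    simp [smul_eq_mul]
  -- the time condition: `τ ↦ Φ τ x₁` is maximal at `t₁` on `[s₀, t₁]`
  have hψt : HasDerivAt (fun τ => ψ τ x₁) (K * ψ t₁ x₁) t₁ := by
    show HasDerivAt (fun τ => Real.exp (K * (τ - s₀)) * (1 + ‖x₁‖ ^ 2))
      (K * (Real.exp (K * (t₁ - s₀)) * (1 + ‖x₁‖ ^ 2))) t₁
    have h1 : HasDerivAt (fun τ => K * (τ - s₀)) K t₁ := by
      simpa using ((hasDerivAt_id t₁).sub_const s₀).const_mul K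
    have h2 := (h1.exp).mul_const (1 + ‖x₁‖ ^ 2)
    refine h2.congr_deriv ?_
    ring
  have hΦt : HasDerivAt (fun τ => Φ τ x₁) (d - ε * (K * ψ t₁ x₁) - δ) t₁ := by
    have h1 : HasDerivAt (fun τ => δ * (τ - s₀)) δ t₁ := by
      simpa using ((hasDerivAt_id t₁).sub_const s₀).const_mul δ
    exact (hd.sub (hψt.const_mul ε)).sub h1
  have hDt : 0 ≤ d - ε * (K * ψ t₁ x₁) - δ := by
    have e : s₀ + (t₁ - s₀) = t₁ := by ring
    have hΦt' : HasDerivAt (fun τ => Φ τ x₁) (d - ε * (K * ψ t₁ x₁) - δ) (s₀ + (t₁ - s₀)) := by rw [e]; exact hΦt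
    have hsh : HasDerivAt (fun r => Φ (s₀ + r) x₁) (d - ε * (K * ψ t₁ x₁) - δ) (t₁ - s₀) :=
      HasDerivAt.comp_const_add s₀ (t₁ - s₀) hΦt'
    refine Literature.Analysis.PDE.deriv_nonneg_of_isMaxOn_Icc_left (w := fun r => Φ (s₀ + r) x₁)
      (D := d - ε * (K * ψ t₁ x₁) - δ) (t₀ := t₁ - s₀) (s := univ) (by linarith) (subset_univ _)
      hsh.hasDerivWithinAt fun r hr => ?_
    show Φ (s₀ + r) x₁ ≤ Φ (s₀ + (t₁ - s₀)) x₁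
    rw [e]
    exact hmax (show ((s₀ + r, x₁) : ℝ × LiouvilleSocket.E3) ∈ S from ⟨⟨by linarith [hr.1], by linarith [hr.2, ht₁.2]⟩, hx₁⟩)
  -- the barrier is a transport supersolution: `K(1+‖x‖²) − 2Λ‖x‖ ≥ 6 ≥ 0`
  have hbar : 0 ≤ K * (1 + ‖x₁‖ ^ 2) - 2 * Λ * ‖x₁‖ - 6 := by
    have hN := norm_nonneg x₁
    have h1 : 0 ≤ 1 + ‖x₁‖ ^ 2 - ‖x₁‖ := by nlinarith [sq_nonneg (‖x₁‖ - 1)]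
    have e : K * (1 + ‖x₁‖ ^ 2) - 2 * Λ * ‖x₁‖ - 6 = 2 * Λ * (1 + ‖x₁‖ ^ 2 - ‖x₁‖) + 6 * ‖x₁‖ ^ 2 := by
      rw [hK]; ring
    rw [e]
    exact add_nonneg (mul_nonneg (by positivity) h1) (by positivity)
  have hinner : -(‖x₁‖ * Λ) ≤ ⟪x₁, b t₁ x₁⟫_ℝ := by
    have h1 := real_inner_le_norm x₁ (b t₁ x₁)
    have h2 := abs_real_inner_le_norm x₁ (b t₁ x₁)
    have h3 : ‖x₁‖ * ‖b t₁ x₁‖ ≤ ‖x₁‖ * Λ := mul_le_mul_of_nonneg_left hb (norm_nonneg _)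
    have := neg_abs_le ⟪x₁, b t₁ x₁⟫_ℝ
    linarith
  -- combine: `d + Dq[b] ≥ δ + ε e^{K(t₁−s₀)} (K(1+‖x₁‖²) − 2Λ‖x₁‖) > 0`
  obtain ⟨P, hP⟩ : ∃ P : ℝ, P = ε * Real.exp (K * (t₁ - s₀)) := ⟨_, rfl⟩
  have hP0 : 0 ≤ P := by rw [hP]; positivity
  have hψval : ψ t₁ x₁ = Real.exp (K * (t₁ - s₀)) * (1 + ‖x₁‖ ^ 2) := rfl
  rw [hψval] at hDt
  have e1 : ε * (K * (Real.exp (K * (t₁ - s₀)) * (1 + ‖x₁‖ ^ 2))) = K * P * (1 + ‖x₁‖ ^ 2) := by rw [hP]; ring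
  have F1 : K * P * (1 + ‖x₁‖ ^ 2) + δ ≤ d := by linarith [hDt, e1.le, e1.ge]
  have e2 : ε * (Real.exp (K * (t₁ - s₀)) * (2 * ⟪x₁, b t₁ x₁⟫_ℝ)) = 2 * P * ⟪x₁, b t₁ x₁⟫_ℝ := by rw [hP]; ring
  rw [hDq, e2] at hineq
  have F4 : -(2 * P * (‖x₁‖ * Λ)) ≤ 2 * P * ⟪x₁, b t₁ x₁⟫_ℝ := by
    have h := mul_le_mul_of_nonneg_left hinner (by positivity : (0 : ℝ) ≤ 2 * P)
    rwa [mul_neg] at h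
  have F5 : 0 ≤ K * P * (1 + ‖x₁‖ ^ 2) - 2 * P * (‖x₁‖ * Λ) - 6 * P := by
    have h := mul_nonneg hP0 hbar
    have e5 : P * (K * (1 + ‖x₁‖ ^ 2) - 2 * Λ * ‖x₁‖ - 6) =
        K * P * (1 + ‖x₁‖ ^ 2) - 2 * P * (‖x₁‖ * Λ) - 6 * P := by ring
    linarith [h, e5.le, e5.ge]
  linarith [F1, F4, F5, hineq, hδpos, hP0]

end Summit.NavierStokesRegularity.NavierStokesRegularity.Theorems.ScenarioCensus.RateTable

end

/-! Build note (typer-1 g9, 12:04Z): no-op append to re-trigger the farm build of this module (it stayed `unbuilt` after acceptance, blocking its importers). -/
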